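import Literature.Barriers.CriticalPhenomena.SAPAnisotropicNotDFinite
import Mathlib.Analysis.Complex.Basic
import Mathlib.RingTheory.EuclideanDomain
import Mathlib.RingTheory.Polynomial.Cyclotomic.Roots
import Mathlib.RingTheory.Polynomial.Pochhammer
import Mathlib.RingTheory.RootsOfUnity.Complex
import Mathlib.Topology.Algebra.Polynomial
import Mathlib.Topology.DerivedSet
import Mathlib.Topology.DiscreteSubset
import HarnessLib

/-!
# Rechnitzer's Corollary 27, proved from the haruspicy facts: the pole theorem for D-finite
# series (Theorem 15, Bousquet-Mélou–Rechnitzer) and the assembly `thm1 → thm16 → cor27`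

Topic `Literature/Barriers/CriticalPhenomena`; companion of `SAPAnisotropicNotDFinite`, which
vendors A. Rechnitzer, *Haruspicy 2: The anisotropic generating function of self-avoiding
polygons is not D-finite*, J. Combin. Theory Ser. A 113 (2006) 520–546 (numbering of
arXiv:math/0406450v2) as the named facts `Rechnitzer2006_thm1` (Theorem 1: every row
`H_n(x)` of `P(x,y) = Σ_n H_n(x) yⁿ` is rational with cyclotomic denominator),
`Rechnitzer2006_thm16` (Theorem 16: for `k ≠ 2`, `H_{3k-2}` has a simple pole at the zeros of
`Ψ_k`) and `Rechnitzer2006_cor27` = the barrier `SAPAnisotropicNotDFinite`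
(`¬ IsDFiniteInY (sapAnisotropicGF ℂ)`).

The printed proof of Corollary 27 (arXiv p. 12): "For any `q ∈ ℚ`, there exists `k`, such that
`Ψ_k(e^{2πiq}) = 0`. By Theorem 16, `H_{3k-2}(x)` is singular at `x = e^{2πiq}`, excepting
`x = -1`. Hence the set `S` is dense on the unit circle, `|x| = 1`. Consequently `S` has an
infinite number of accumulation points and so `G(x,y) = Σ H_n(x) yⁿ` is not a D-finite power
series in `y`" — the last step being **Theorem 15** (from Bousquet-Mélou–Rechnitzer, *Lattice
animals and heaps of dimers*, Discrete Math. 258 (2002) 235–274): "Let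
`f(x,y) = Σ_{n ≥ 0} yⁿ H_n(x)` be a D-finite series in `y` with coefficients `H_n(x)` that are
rational functions of `x`. For `n ≥ 0` let `S_n` be the set of poles of `H_n(x)`, and let
`S = ⋃_n S_n`. Then `S` has only a finite number of accumulation points."

This file PROVES Theorem 15 in the setting of the fact file (series in `ℂ⟦x⟧⟦y⟧`, i.e. rows
regular at `x = 0`, the case of `P(x,y)`; D-finite = `IsDFiniteInY`, eq. (7) of the source) and
then proves Corollary 27 from the two haruspicy facts, so that an unconditional
`Rechnitzer2006_cor27_holds` now requires exactly `Rechnitzer2006_thm1` and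
`Rechnitzer2006_thm16` (Rechnitzer 2003's haruspicy theory and §§2–3 of the source: section
deletion, 2-4-2 polygons, the Hadamard-product functional equation — not formalised).

## Contents (namespace `Literature.Barriers.CriticalPhenomena`)

* `IsDenom H D`, `IsRationalSeries H`, `poleSet H` for `H ∈ K⟦x⟧` (`K` a field): `D ≠ 0` with
  `D · H ∈ K[x]`; some denominator exists; the common zeros in `K` of all denominators. Kept
  elementary (no `RatFunc`/Laurent-series coercions); `poleSet_eq_of_isCoprime` certifies that
  for `H = N/D` in lowest terms the poles are the zeros of `D`,
  `IsRationalSeries.exists_poleSet_eq` that lowest terms exist (`gcd` in `K[x]`),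
  `mem_poleSet_map_of_isCoprime` that poles read off over `ℚ` persist over `ℂ`.
* D-finite ⇒ P-recursive (`IsDFiniteInY.exists_recurrence`): multiplying
  `Σ_j Q_j ∂ʲ_y G = 0` by `y^d` gives `Σ_j R_j · (yʲ∂ʲ_y G) = 0`, `R_j = Q_j y^{d-j}`, and
  `[yᵇ](yʲ∂ʲG) = b(b-1)⋯(b-j+1) H_b` (`coeff_X_pow_mul_iterate_derivativeFun`), whence
  `Σ_{a+b=n} Λ_a(b) H_b = 0` with `Λ_a = Σ_j [yᵃ]R_j · T(T-1)⋯(T-j+1) ∈ K[x][T]` (`recPoly`,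
  Mathlib's `descPochhammer`); the falling factorials have distinct degrees, so some `Λ_a ≠ 0`
  (`recPoly_ne_zero`), and the least such `a₀` gives `Λ_{a₀}(m) H_m ∈ Σ_{b<m} K[x] H_b`.
* Pole propagation (`poleSet_subset_of_recurrence`): clearing denominators, the poles of `H_m`
  are zeros of `Λ_{a₀}(m) ∈ K[x]` or poles of earlier rows; `Λ_{a₀}(m) = 0` for only finitely
  many `m` in characteristic `0` (`exists_forall_eval_natCast_ne_zero`).
* The analytic step over `ℂ` (`exists_nhds_forall_eval_eval_ne_zero`,
  `derivedSet_iUnion_roots_subset`): near a point where the leading coefficient `λ_e(x)` of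
  `Λ_{a₀} = Σ_k λ_k(x) Tᵏ` does not vanish, `|λ_e(w)| mᵉ > Σ_{k<e} |λ_k(w)| mᵏ` for `m` large,
  so the zeros of the `Λ_{a₀}(m)(x)` accumulate only at zeros of `λ_e`: a finite set.
* `finite_derivedSet_iUnion_poleSet`, `Rechnitzer2006_thm15` (named, faithful) and
  `Rechnitzer2006_thm15_holds` (Theorem 15, PROVED).
* `infinite_derivedSet_rootsOfUnity`, `infinite_derivedSet_primitiveRoots`: the roots of unity
  other than `-1` have infinitely many accumulation points (an infinite subset of the compact
  unit circle has an accumulation point `z₀`; its rotations `ω z₀` are accumulation points too).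
* `isRationalSeries_sapRowGF` (Theorem 1 ⇒ rows rational over `ℂ`), `mem_poleSet_sapRowGF`
  (Theorem 16 ⇒ every primitive `k`-th root of unity, `k ≥ 1`, `k ≠ 2`, is a pole of
  `H_{3k-2}` over `ℂ`), and the assembly `Rechnitzer2006_cor27_of_thm1_thm16 :
  Rechnitzer2006_thm1 → Rechnitzer2006_thm16 → Rechnitzer2006_cor27`
  (also `sapAnisotropicNotDFinite_of_thm1_thm16`).
* Beyond the D-finite class (closure of the pole obstruction under ring operations and
  division): `IsDenom.mul/add/neg/sum`, `poleSet_mul_subset`, `poleSet_subset_of_eq_add_sum`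
  (if `ℓ · f = g₀ + Σ gᵢ` with `ℓ ∈ K[x]` non-zero and rational `g`'s, then `f` is rational with
  poles among the zeros of `ℓ` and the poles of the `g`'s), and
  `sapAnisotropicGF_ne_quotient_of_thm16`: given Theorem 16 alone, `B · P ≠ A` for all `A, B`
  D-finite in `y` with rational rows and `B₀ ≠ 0` — `P` is not a quotient `B⁻¹A` of D-finite
  series (the rows of `B⁻¹A` have poles accumulating only at finitely many points); with `B = 1`,
  `Rechnitzer2006_cor27_of_thm16_of_isRationalSeries` (Corollary 27 from Theorem 16 and the
  rationality of the rows).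

Mathlib: `PowerSeries.coeff_derivativeFun`, `descPochhammer_eval_eq_descFactorial`,
`monic_descPochhammer`, `descPochhammer_natDegree`, `isCoprime_div_gcd_div_gcd`,
`Polynomial.finite_setOf_isRoot`, `Polynomial.isRoot_cyclotomic_iff`,
`Polynomial.map_cyclotomic`, `Complex.isPrimitiveRoot_exp`,
`Set.Infinite.exists_accPt_of_subset_isCompact`, `Set.Infinite.of_accPt`, `derivedSet_union`,
`Continuous.image_derivedSet`.

## References

* A. Rechnitzer, *Haruspicy 2: The anisotropic generating function of self-avoiding polygons is
  not D-finite*, J. Combin. Theory Ser. A 113 (2006) 520–546, arXiv:math/0406450: Theorem 1,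
  §3.1 (Definition 14, eq. (7), Theorems 15 and 16), Corollary 27 and its proof (arXiv p. 12).
  [Rechnitzer2006Haruspicy2]
* M. Bousquet-Mélou, A. Rechnitzer, *Lattice animals and heaps of dimers*, Discrete Math. 258
  (2002) 235–274 (the source of Theorem 15; not consulted — the proof below is the standard
  recurrence argument).
-/

noncomputable section

open Finset Filter Topology PowerSeries
open scoped BigOperators Polynomial

namespace Literature.Barriers.CriticalPhenomena

/-! ### Rational power series, denominators and poles -/

section Poles

variable {K : Type*} [Field K]

/-- `D` is a denominator of the power series `H ∈ K⟦x⟧`: `D ≠ 0` and `D · H` is (the image of)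
a polynomial `N`, i.e. `H` is the expansion at `0` of the rational function `N/D`. [folklore] -/
def IsDenom (H : PowerSeries K) (D : K[X]) : Prop :=
  D ≠ 0 ∧ ∃ N : K[X], (D : PowerSeries K) * H = N

/-- `H ∈ K⟦x⟧` is (the Taylor expansion at `0` of) a rational function of `x`. [folklore] -/
def IsRationalSeries (H : PowerSeries K) : Prop :=
  ∃ D : K[X], IsDenom H D

/-- The set of poles (in `K`) of a rational power series `H`: the common zeros of all its
denominators; for `H = N/D` in lowest terms this is the zero set of `D`
(`poleSet_eq_of_isCoprime`). (Junk value: all of `K` when `H` is not rational.) [folklore] -/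
def poleSet (H : PowerSeries K) : Set K :=
  {z | ∀ D : K[X], IsDenom H D → D.IsRoot z}

/-- The poles of `H` are among the zeros of any of its denominators. [folklore] -/
theorem poleSet_subset_of_isDenom {H : PowerSeries K} {D : K[X]} (hD : IsDenom H D) :
    poleSet H ⊆ {z | D.IsRoot z} :=
  fun _ hz => hz D hD

/-- A rational series has finitely many poles. [folklore] -/
theorem IsRationalSeries.finite_poleSet {H : PowerSeries K} (hH : IsRationalSeries H) :
    (poleSet H).Finite := by
  obtain ⟨D, hD⟩ := hH
  exact (Polynomial.finite_setOf_isRoot hD.1).subset (poleSet_subset_of_isDenom hD)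

/-- Two representations `D · H = N`, `D' · H = N'` of the same series cross-multiply. [folklore] -/
theorem cross_mul_eq {H : PowerSeries K} {D N D' N' : K[X]}
    (h : (D : PowerSeries K) * H = N) (h' : (D' : PowerSeries K) * H = N') :
    D' * N = D * N' := by
  apply Polynomial.coe_injective K
  rw [Polynomial.coe_mul, Polynomial.coe_mul, ← h, ← h']
  ring

/-- The zeros of the denominator of a representation `H = N/D` in lowest terms are poles.
[folklore] -/
theorem mem_poleSet_of_isCoprime {H : PowerSeries K} {N D : K[X]} (hND : IsCoprime N D)
    (h : (D : PowerSeries K) * H = N) {z : K} (hz : D.IsRoot z) : z ∈ poleSet H := by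
  rintro D' ⟨-, N', h'⟩
  have hdvd : D ∣ D' * N := ⟨N', cross_mul_eq h h'⟩
  exact hz.dvd (hND.symm.dvd_of_dvd_mul_right hdvd)

/-- For `H = N/D` in lowest terms, the poles of `H` are exactly the zeros of `D`. [folklore] -/
theorem poleSet_eq_of_isCoprime {H : PowerSeries K} {N D : K[X]} (hND : IsCoprime N D)
    (hD : D ≠ 0) (h : (D : PowerSeries K) * H = N) : poleSet H = {z | D.IsRoot z} :=
  Set.Subset.antisymm (poleSet_subset_of_isDenom ⟨hD, N, h⟩)
    fun _ hz => mem_poleSet_of_isCoprime hND h hz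

/-- Every rational series has a lowest-terms denominator, whose zero set is the pole set.
[folklore] -/
theorem IsRationalSeries.exists_poleSet_eq {H : PowerSeries K} (hH : IsRationalSeries H) :
    ∃ D : K[X], IsDenom H D ∧ poleSet H = {z | D.IsRoot z} := by
  classical
  obtain ⟨D, hD0, N, h⟩ := hH
  have hg : GCDMonoid.gcd N D ≠ 0 := gcd_ne_zero_of_right hD0
  have hDg : D = GCDMonoid.gcd N D * (D / GCDMonoid.gcd N D) :=
    (EuclideanDomain.mul_div_cancel' hg (GCDMonoid.gcd_dvd_right N D)).symm
  have hNg : N = GCDMonoid.gcd N D * (N / GCDMonoid.gcd N D) :=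
    (EuclideanDomain.mul_div_cancel' hg (GCDMonoid.gcd_dvd_left N D)).symm
  have h' : ((D / GCDMonoid.gcd N D : K[X]) : PowerSeries K) * H =
      (N / GCDMonoid.gcd N D : K[X]) := by
    have hg' : ((GCDMonoid.gcd N D : K[X]) : PowerSeries K) ≠ 0 := by
      simpa using hg
    apply mul_left_cancel₀ hg'
    rw [← mul_assoc, ← Polynomial.coe_mul, ← hDg, ← Polynomial.coe_mul, ← hNg, h]
  exact ⟨D / GCDMonoid.gcd N D, ⟨right_div_gcd_ne_zero hD0, _, h'⟩,
    poleSet_eq_of_isCoprime (isCoprime_div_gcd_div_gcd hD0) (right_div_gcd_ne_zero hD0) h'⟩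

/-- Rationality and lowest-terms denominators are preserved by extension of scalars, so poles
read off over a subfield persist: if `N/D` is in lowest terms over `K` and `D · H = N`, then
every zero in `L` of `D` is a pole of the base-changed series. [folklore] -/
theorem mem_poleSet_map_of_isCoprime {L : Type*} [Field L] (f : K →+* L) {H : PowerSeries K}
    {N D : K[X]} (hND : IsCoprime N D) (h : (D : PowerSeries K) * H = N) {z : L}
    (hz : (D.map f).IsRoot z) : z ∈ poleSet (PowerSeries.map f H) := by
  refine mem_poleSet_of_isCoprime (hND.map (Polynomial.mapRingHom f)) ?_ hz
  change ((D.map f : L[X]) : PowerSeries L) * PowerSeries.map f H = (N.map f : L[X])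
  rw [Polynomial.polynomial_map_coe, Polynomial.polynomial_map_coe, ← map_mul, h]

end Poles

/-! ### Coefficients of iterated `y`-derivatives -/

section Derivatives

variable {R : Type*} [CommSemiring R]

/-- `[yᵐ] ∂ʲ G = (m+j)(m+j-1)⋯(m+1) · [y^{m+j}] G`. [folklore] -/
theorem coeff_iterate_derivativeFun (G : PowerSeries R) (j m : ℕ) :
    coeff m (derivativeFun^[j] G) = coeff (m + j) G * ((m + j).descFactorial j : ℕ) := by
  induction j generalizing G m with
  | zero => simp
  | succ j ih =>
    rw [Function.iterate_succ_apply, ih, coeff_derivativeFun,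
      show m + (j + 1) = (m + j) + 1 by ring, Nat.succ_descFactorial_succ]
    push_cast
    ring

/-- `[yᵇ] (yʲ ∂ʲ G) = b(b-1)⋯(b-j+1) · [yᵇ] G` (the falling factorial vanishes for `b < j`).
[folklore] -/
theorem coeff_X_pow_mul_iterate_derivativeFun (G : PowerSeries R) (j b : ℕ) :
    coeff b (X ^ j * derivativeFun^[j] G) = ((b.descFactorial j : ℕ) : R) * coeff b G := by
  rw [coeff_X_pow_mul']
  split_ifs with h
  · rw [coeff_iterate_derivativeFun, tsub_add_cancel_of_le h, mul_comm]
  · rw [Nat.descFactorial_eq_zero_iff_lt.mpr (not_le.mp h)]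
    simp

end Derivatives

/-! ### From a differential equation in `y` to a recurrence for the coefficients -/

section PolyXY

variable {K : Type*} [CommSemiring K]

/-- `polyXY (y) = y`. [folklore] -/
theorem polyXY_X : polyXY (Polynomial.X : Polynomial (Polynomial K)) = PowerSeries.X := by
  simp [polyXY]

/-- `[yᵃ] Q(x,y) ∈ K[x] ⊆ K⟦x⟧`. [folklore] -/
theorem coeff_polyXY (P : Polynomial (Polynomial K)) (a : ℕ) :
    coeff a (polyXY P) = (P.coeff a : PowerSeries K) := by
  ext m
  rw [coeff_coeff_polyXY, Polynomial.coeff_coe]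

end PolyXY

section Recurrence

variable {K : Type*} [Field K]

/-- Coercion `K[x] → K⟦x⟧` on negatives. [folklore] -/
theorem coe_poly_neg (φ : K[X]) : ((-φ : K[X]) : PowerSeries K) = -(φ : PowerSeries K) :=
  (Polynomial.coeToPowerSeries.ringHom (R := K)).map_neg φ

/-- Coercion `K[x] → K⟦x⟧` on finite sums. [folklore] -/
theorem coe_poly_sum {ι : Type*} (s : Finset ι) (f : ι → K[X]) :
    ((∑ i ∈ s, f i : K[X]) : PowerSeries K) = ∑ i ∈ s, (f i : PowerSeries K) :=
  map_sum (Polynomial.coeToPowerSeries.ringHom (R := K)) f s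

/-- Coercion `K[x] → K⟦x⟧` on finite products. [folklore] -/
theorem coe_poly_prod {ι : Type*} (s : Finset ι) (f : ι → K[X]) :
    ((∏ i ∈ s, f i : K[X]) : PowerSeries K) = ∏ i ∈ s, (f i : PowerSeries K) :=
  map_prod (Polynomial.coeToPowerSeries.ringHom (R := K)) f s

/-- Coercion `K[x] → K⟦x⟧` on naturals. [folklore] -/
theorem coe_poly_natCast (n : ℕ) : ((n : K[X]) : PowerSeries K) = n :=
  map_natCast (Polynomial.coeToPowerSeries.ringHom (R := K)) n

/-- The polynomial `Λ_a(T) = Σ_j [yᵃ]R_j(x,y) · T(T-1)⋯(T-j+1) ∈ K[x][T]` attached to a family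
`R_0, …, R_d ∈ K[x][y]`: the coefficient of `H_b(x)` coming from `yᵃ` in the `θ`-form
`Σ_j R_j · yʲ∂ʲ` of a differential operator is `Λ_a(b)`. (The outer polynomial variable is the
recurrence variable `T`, the inner one is `x`.) [folklore] -/
def recPoly {d : ℕ} (R : Fin (d + 1) → Polynomial (Polynomial K)) (a : ℕ) :
    Polynomial (Polynomial K) :=
  ∑ j : Fin (d + 1), Polynomial.C ((R j).coeff a) * descPochhammer (Polynomial K) j

/-- `Λ_a(b) = Σ_j [yᵃ]R_j · b(b-1)⋯(b-j+1)` at natural numbers `b`. [folklore] -/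
theorem eval_recPoly {d : ℕ} (R : Fin (d + 1) → Polynomial (Polynomial K)) (a b : ℕ) :
    (recPoly R a).eval (b : Polynomial K) =
      ∑ j : Fin (d + 1), (R j).coeff a * ((b.descFactorial j : ℕ) : Polynomial K) := by
  simp [recPoly, Polynomial.eval_finsetSum, descPochhammer_eval_eq_descFactorial]

/-- The falling factorials `T(T-1)⋯(T-j+1)` have distinct degrees, so `Λ_a ≠ 0` as soon as one
of the coefficients `[yᵃ]R_j` is non-zero. [folklore] -/
theorem recPoly_ne_zero {d : ℕ} (R : Fin (d + 1) → Polynomial (Polynomial K)) {a : ℕ}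
    (h : ∃ j, (R j).coeff a ≠ 0) : recPoly R a ≠ 0 := by
  classical
  set J := Finset.univ.filter (fun j : Fin (d + 1) => (R j).coeff a ≠ 0) with hJ
  have hJne : J.Nonempty := by
    obtain ⟨j, hj⟩ := h
    exact ⟨j, by simp [hJ, hj]⟩
  set j₁ := J.max' hJne with hj₁
  have hj₁mem : (R j₁).coeff a ≠ 0 := by
    have := J.max'_mem hJne
    simp only [Finset.mem_filter, Finset.mem_univ, true_and, J] at this
    exact this
  intro h0
  have hc := congr_arg (fun p : Polynomial (Polynomial K) => p.coeff (j₁ : ℕ)) h0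
  simp only [recPoly, Polynomial.finsetSum_coeff, Polynomial.coeff_C_mul,
    Polynomial.coeff_zero] at hc
  rw [Finset.sum_eq_single j₁] at hc
  · have hmonic := (monic_descPochhammer (Polynomial K) (j₁ : ℕ)).coeff_natDegree
    rw [descPochhammer_natDegree] at hmonic
    rw [hmonic, mul_one] at hc
    exact hj₁mem hc
  · intro j _ hne
    by_cases hj : (R j).coeff a = 0
    · rw [hj, zero_mul]
    · have hjJ : j ∈ J := by simp [hJ, hj]
      have hle : j ≤ j₁ := J.le_max' j hjJ
      have hlt : (j : ℕ) < j₁ := lt_of_le_of_ne (Fin.le_iff_val_le_val.mp hle)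
        (fun h => hne (Fin.ext h))
      rw [Polynomial.coeff_eq_zero_of_natDegree_lt (p := descPochhammer (Polynomial K) j)
        (by rwa [descPochhammer_natDegree]), mul_zero]
  · intro h
    exact absurd (Finset.mem_univ _) h

/-- **Coefficient extraction.** If `Σ_{j ≤ d} Q_j(x,y) ∂ʲ_y G = 0`, then with
`R_j = Q_j · y^{d-j}` (so that `y^d · Q_j ∂ʲ = R_j · yʲ∂ʲ`) the coefficients `H_b = [yᵇ] G`
satisfy, for every `n`, `Σ_{a+b=n} Λ_a(b) · H_b = 0`. [folklore] -/
theorem sum_antidiagonal_eval_recPoly_mul_coeff {G : PowerSeries (PowerSeries K)} {d : ℕ}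
    {Q : Fin (d + 1) → Polynomial (Polynomial K)}
    (hsum : ∑ j : Fin (d + 1), polyXY (Q j) * derivativeFun^[j] G = 0) (n : ℕ) :
    ∑ p ∈ antidiagonal n,
      (((recPoly (fun j => Q j * Polynomial.X ^ (d - j)) p.1).eval (p.2 : Polynomial K) :
        Polynomial K) : PowerSeries K) * coeff p.2 G = 0 := by
  set R : Fin (d + 1) → Polynomial (Polynomial K) := fun j => Q j * Polynomial.X ^ (d - (j : ℕ))
    with hR
  -- `y^d · (Σ_j Q_j ∂ʲ G) = Σ_j R_j · (yʲ ∂ʲ G)`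
  have h1 : ∑ j : Fin (d + 1), polyXY (R j) * (X ^ (j : ℕ) * derivativeFun^[j] G) = 0 := by
    have : ∀ j : Fin (d + 1), polyXY (R j) * (X ^ (j : ℕ) * derivativeFun^[j] G) =
        X ^ d * (polyXY (Q j) * derivativeFun^[j] G) := by
      intro j
      simp only [hR, map_mul, map_pow, polyXY_X]
      rw [← pow_sub_mul_pow (X : PowerSeries (PowerSeries K)) (Nat.lt_succ_iff.mp j.2)]
      ring
    rw [Finset.sum_congr rfl fun j _ => this j, ← Finset.mul_sum, hsum, mul_zero]
  have h3 : ∀ j : Fin (d + 1), coeff n (polyXY (R j) * (X ^ (j : ℕ) * derivativeFun^[j] G)) =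
      ∑ p ∈ antidiagonal n, ((R j).coeff p.1 : PowerSeries K) *
        ((((p.2).descFactorial j : ℕ) : PowerSeries K) * coeff p.2 G) := by
    intro j
    rw [coeff_mul]
    refine Finset.sum_congr rfl fun p _ => ?_
    rw [coeff_polyXY, coeff_X_pow_mul_iterate_derivativeFun]
  have h2 := congr_arg (coeff n) h1
  rw [map_sum, map_zero, Finset.sum_congr rfl fun j _ => h3 j, Finset.sum_comm] at h2
  rw [← h2]
  refine Finset.sum_congr rfl fun p _ => ?_
  rw [eval_recPoly, coe_poly_sum, Finset.sum_mul]
  refine Finset.sum_congr rfl fun j _ => ?_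
  rw [Polynomial.coe_mul, coe_poly_natCast]
  ring

/-- **D-finite ⇒ P-recursive** (the algebraic half of Theorem 15): if `G = Σ_m H_m(x) yᵐ` is
D-finite in `y`, there is a non-zero `Λ ∈ K[x][T]` such that, for every `m`, `Λ(m) · H_m` is a
`K[x]`-linear combination of `H_b` with `b < m`. [folklore] -/
theorem IsDFiniteInY.exists_recurrence {G : PowerSeries (PowerSeries K)} (hG : IsDFiniteInY G) :
    ∃ P : Polynomial (Polynomial K), P ≠ 0 ∧ ∀ m : ℕ,
      ∃ (s : Finset ℕ) (c : ℕ → Polynomial K) (b : ℕ → ℕ), (∀ k ∈ s, b k < m) ∧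
        ((P.eval (m : Polynomial K) : Polynomial K) : PowerSeries K) * coeff m G =
          ∑ k ∈ s, (c k : PowerSeries K) * coeff (b k) G := by
  classical
  obtain ⟨d, Q, hQ, hsum⟩ := hG
  set R : Fin (d + 1) → Polynomial (Polynomial K) := fun j => Q j * Polynomial.X ^ (d - (j : ℕ))
    with hR
  -- some `Λ_a` is non-zero
  have hex : ∃ a, recPoly R a ≠ 0 := by
    obtain ⟨j₀, hj₀⟩ : ∃ j₀, Q j₀ ≠ 0 := by
      by_contra! h
      exact hQ (funext h)
    have hR0 : R j₀ ≠ 0 := mul_ne_zero hj₀ (pow_ne_zero _ Polynomial.X_ne_zero)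
    obtain ⟨a, ha⟩ : ∃ a, (R j₀).coeff a ≠ 0 := by
      by_contra! h
      exact hR0 (Polynomial.ext fun a => by simpa using h a)
    exact ⟨a, recPoly_ne_zero R ⟨j₀, ha⟩⟩
  set a₀ := Nat.find hex with ha₀
  have hP : recPoly R a₀ ≠ 0 := Nat.find_spec hex
  have hlt : ∀ a, a < a₀ → recPoly R a = 0 := fun a ha => by
    have := Nat.find_min hex (ha₀ ▸ ha)
    simpa using this
  refine ⟨recPoly R a₀, hP, fun m => ?_⟩
  -- the identity at `n = a₀ + m`, as a sum over `a ∈ [0, a₀ + m]`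
  have hid := sum_antidiagonal_eval_recPoly_mul_coeff hsum (a₀ + m)
  rw [Finset.Nat.sum_antidiagonal_eq_sum_range_succ_mk, Finset.range_eq_Ico,
    ← Finset.sum_Ico_consecutive _ (Nat.zero_le a₀) (by omega : a₀ ≤ a₀ + m + 1),
    Finset.sum_eq_sum_Ico_succ_bot (by omega : a₀ < a₀ + m + 1),
    Finset.sum_eq_zero (fun k hk => by
      rw [hlt k (Finset.mem_Ico.mp hk).2, Polynomial.eval_zero, Polynomial.coe_zero, zero_mul]),
    zero_add, Nat.add_sub_cancel_left] at hid
  refine ⟨Finset.Ico (a₀ + 1) (a₀ + m + 1),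
    fun k => -((recPoly R k).eval ((a₀ + m - k : ℕ) : Polynomial K)), fun k => a₀ + m - k,
    fun k hk => ?_, ?_⟩
  · show a₀ + m - k < m
    have := (Finset.mem_Ico.mp hk)
    omega
  · rw [eq_neg_of_add_eq_zero_left hid, ← Finset.sum_neg_distrib]
    refine Finset.sum_congr rfl fun k _ => ?_
    rw [coe_poly_neg, neg_mul]

end Recurrence

/-! ### Pole propagation along the recurrence -/

section PolePropagation

variable {K : Type*} [Field K]

/-- One step of the pole propagation: if `ℓ · H_m = Σ_{k ∈ s} c_k · H_{b_k}` in `K⟦x⟧` with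
`ℓ ≠ 0` and every `H_{b_k}` rational, then each pole of `H_m` is a zero of `ℓ` or a pole of some
`H_{b_k}` (clear denominators: `ℓ · ∏ D_{b_k}` is a denominator of `H_m`). [folklore] -/
theorem poleSet_subset_of_recurrence {H : ℕ → PowerSeries K} {m : ℕ} {ℓ : K[X]} (hℓ : ℓ ≠ 0)
    {s : Finset ℕ} {c : ℕ → K[X]} {b : ℕ → ℕ}
    (hrec : (ℓ : PowerSeries K) * H m = ∑ k ∈ s, (c k : PowerSeries K) * H (b k))
    (hrat : ∀ k ∈ s, IsRationalSeries (H (b k))) :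
    poleSet (H m) ⊆ {z | ℓ.IsRoot z} ∪ ⋃ k ∈ s, poleSet (H (b k)) := by
  classical
  choose! D hD hDeq using fun k (hk : k ∈ s) => (hrat k hk).exists_poleSet_eq
  have hN : ∀ k ∈ s, ∃ N : K[X], (D k : PowerSeries K) * H (b k) = N := fun k hk => (hD k hk).2
  choose! N hN using hN
  have hden : IsDenom (H m) (ℓ * ∏ k ∈ s, D k) := by
    refine ⟨mul_ne_zero hℓ (Finset.prod_ne_zero_iff.mpr fun k hk => (hD k hk).1),
      ∑ k ∈ s, c k * N k * ∏ k' ∈ s.erase k, D k', ?_⟩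
    rw [Polynomial.coe_mul, mul_comm, ← mul_assoc, mul_comm (H m), hrec, Finset.sum_mul,
      coe_poly_sum]
    refine Finset.sum_congr rfl fun k hk => ?_
    rw [← Finset.mul_prod_erase s D hk, Polynomial.coe_mul, Polynomial.coe_mul,
      Polynomial.coe_mul, coe_poly_prod, ← hN k hk]
    ring
  intro z hz
  have hroot := poleSet_subset_of_isDenom hden hz
  simp only [Set.mem_setOf_eq, Polynomial.root_mul, Polynomial.isRoot_prod] at hroot
  rcases hroot with h | ⟨k, hk, hk'⟩
  · exact Or.inl h
  · refine Or.inr (Set.mem_iUnion₂.mpr ⟨k, hk, ?_⟩)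
    rw [hDeq k hk]
    exact hk'

/-- A non-zero `Λ ∈ K[x][T]` (`K` of characteristic zero) vanishes identically in `x` at only
finitely many natural numbers `T = m`. [folklore] -/
theorem exists_forall_eval_natCast_ne_zero [CharZero K] {P : Polynomial (Polynomial K)}
    (hP : P ≠ 0) : ∃ m₁ : ℕ, ∀ m, m₁ ≤ m → P.eval (m : Polynomial K) ≠ 0 := by
  have hfin : {m : ℕ | P.IsRoot (m : Polynomial K)}.Finite :=
    (Polynomial.finite_setOf_isRoot hP).preimage (f := fun m : ℕ => (m : Polynomial K))
      Nat.cast_injective.injOn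
  obtain ⟨m₁, hm₁⟩ := hfin.bddAbove
  refine ⟨m₁ + 1, fun m hm h => ?_⟩
  have : m ≤ m₁ := hm₁ h
  omega

end PolePropagation

/-! ### Accumulation points of the zeros of `Λ(m)(x)`, `m → ∞` -/

section Analytic

/-- For `Λ = Σ_k λ_k(x) Tᵏ ∈ ℂ[x][T]`: `Λ(m)(z) = Σ_k λ_k(z) mᵏ`. [folklore] -/
theorem eval_eval_natCast (P : Polynomial (Polynomial ℂ)) (m : ℕ) (z : ℂ) :
    (P.eval (m : Polynomial ℂ)).eval z =
      ∑ k ∈ Finset.range (P.natDegree + 1), (P.coeff k).eval z * (m : ℂ) ^ k := by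
  have : P.eval (m : Polynomial ℂ) =
      ∑ i ∈ Finset.range (P.natDegree + 1), P.coeff i * (m : Polynomial ℂ) ^ i :=
    Polynomial.eval_eq_sum_range _
  rw [this, Polynomial.eval_finsetSum]
  simp [Polynomial.eval_mul, Polynomial.eval_pow, Polynomial.eval_natCast]

/-- Local finiteness: near a point where the leading coefficient `λ_e(x)` of `Λ` does not vanish,
the polynomials `Λ(m)(x)` have no zeros once `m` is large (`|λ_e| mᵉ` dominates
`Σ_{k<e} |λ_k| mᵏ`). [folklore] -/
theorem exists_nhds_forall_eval_eval_ne_zero (P : Polynomial (Polynomial ℂ)) {z₀ : ℂ}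
    (hz₀ : ¬ P.leadingCoeff.IsRoot z₀) :
    ∃ U ∈ 𝓝 z₀, ∃ M : ℕ, ∀ w ∈ U, ∀ m : ℕ, M ≤ m → (P.eval (m : Polynomial ℂ)).eval w ≠ 0 := by
  set lam : ℕ → ℂ → ℂ := fun k w => (P.coeff k).eval w with hlam
  have hcont : ∀ k, Continuous (lam k) := fun k => Polynomial.continuous (P.coeff k)
  have hlead : lam P.natDegree z₀ ≠ 0 := hz₀
  set c : ℝ := ‖lam P.natDegree z₀‖ / 2 with hc
  have hc0 : 0 < c := half_pos (norm_pos_iff.mpr hlead)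
  set B : ℝ := ∑ k ∈ Finset.range P.natDegree, (‖lam k z₀‖ + 1) with hB
  have hB0 : 0 ≤ B := Finset.sum_nonneg fun k _ => by positivity
  have hU1 : ∀ᶠ w in 𝓝 z₀, c < ‖lam P.natDegree w‖ :=
    continuous_const.continuousAt.eventually_lt (hcont _).norm.continuousAt (by
      show c < ‖lam P.natDegree z₀‖
      linarith)
  have hU2 : ∀ᶠ w in 𝓝 z₀, ∀ k ∈ Finset.range P.natDegree, ‖lam k w‖ < ‖lam k z₀‖ + 1 :=
    (Filter.eventually_all_finset _).mpr fun k _ =>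
      (hcont k).norm.continuousAt.eventually_lt continuous_const.continuousAt (by linarith)
  obtain ⟨M, hM⟩ := exists_nat_gt (B / c)
  refine ⟨{w | c < ‖lam P.natDegree w‖ ∧ ∀ k ∈ Finset.range P.natDegree,
    ‖lam k w‖ < ‖lam k z₀‖ + 1}, hU1.and hU2, M, ?_⟩
  rintro w ⟨hw1, hw2⟩ m hm h0
  have hBM : B < M * c := (div_lt_iff₀ hc0).mp hM
  have hM1 : (1 : ℝ) ≤ M := by
    have h0M : (0 : ℝ) < M := lt_of_le_of_lt (div_nonneg hB0 hc0.le) hM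
    have : 0 < M := by exact_mod_cast h0M
    exact_mod_cast this
  have hm1 : (1 : ℝ) ≤ m := hM1.trans (by exact_mod_cast hm)
  have hm0 : (0 : ℝ) < m := by linarith
  rw [eval_eval_natCast, Finset.sum_range_succ] at h0
  have heq : lam P.natDegree w * (m : ℂ) ^ P.natDegree =
      -∑ k ∈ Finset.range P.natDegree, lam k w * (m : ℂ) ^ k := eq_neg_of_add_eq_zero_right h0
  have key : ‖lam P.natDegree w‖ * (m : ℝ) ^ P.natDegree ≤ B / m * (m : ℝ) ^ P.natDegree :=
    calc ‖lam P.natDegree w‖ * (m : ℝ) ^ P.natDegree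
        = ‖lam P.natDegree w * (m : ℂ) ^ P.natDegree‖ := by
          rw [norm_mul, norm_pow, Complex.norm_natCast]
      _ = ‖∑ k ∈ Finset.range P.natDegree, lam k w * (m : ℂ) ^ k‖ := by rw [heq, norm_neg]
      _ ≤ ∑ k ∈ Finset.range P.natDegree, ‖lam k w * (m : ℂ) ^ k‖ := norm_sum_le _ _
      _ ≤ ∑ k ∈ Finset.range P.natDegree, (‖lam k z₀‖ + 1) * ((m : ℝ) ^ P.natDegree / m) :=
          Finset.sum_le_sum fun k hk => by
            rw [norm_mul, norm_pow, Complex.norm_natCast]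
            have hk' := Finset.mem_range.mp hk
            have hpow : (m : ℝ) ^ k ≤ (m : ℝ) ^ P.natDegree / m := by
              rw [le_div_iff₀ hm0, ← pow_succ]
              exact pow_le_pow_right₀ hm1 (by omega)
            gcongr
            exact (hw2 k hk).le
      _ = B / m * (m : ℝ) ^ P.natDegree := by rw [← Finset.sum_mul, hB]; ring
  have key' : ‖lam P.natDegree w‖ ≤ B / m := le_of_mul_le_mul_right key (by positivity)
  have : c * m < B := by
    have := hw1.trans_le key'
    rwa [lt_div_iff₀ hm0] at this
  have : (M : ℝ) * c ≤ m * c := by gcongr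
  linarith

/-- If `Λ(m) ≠ 0` for `m ≥ m₁`, the accumulation points of `⋃_{m ≥ m₁} {zeros of Λ(m)(x)}`
are zeros of the leading coefficient `λ_e(x)` of `Λ`. [folklore] -/
theorem derivedSet_iUnion_roots_subset (P : Polynomial (Polynomial ℂ)) (m₁ : ℕ)
    (hm₁ : ∀ m, m₁ ≤ m → P.eval (m : Polynomial ℂ) ≠ 0) :
    derivedSet (⋃ m, ⋃ (_ : m₁ ≤ m), {z | (P.eval (m : Polynomial ℂ)).IsRoot z}) ⊆
      {z | P.leadingCoeff.IsRoot z} := by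
  intro z₀ hz₀
  by_contra hne
  obtain ⟨U, hU, M, hM⟩ := exists_nhds_forall_eval_eval_ne_zero P hne
  set R := ⋃ m, ⋃ (_ : m₁ ≤ m), {z | (P.eval (m : Polynomial ℂ)).IsRoot z} with hR
  have hfin : (R ∩ U).Finite := by
    refine (Set.Finite.biUnion (Finset.Ico m₁ M).finite_toSet fun m hm =>
      Polynomial.finite_setOf_isRoot (hm₁ m (Finset.mem_Ico.mp hm).1)).subset ?_
    rintro w ⟨hwR, hwU⟩
    simp only [hR, Set.mem_iUnion, Set.mem_setOf_eq] at hwR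
    obtain ⟨m, hm, hroot⟩ := hwR
    have hmM : m < M := by
      by_contra! h
      exact hM w hwU m h hroot
    exact Set.mem_iUnion₂.mpr ⟨m, Finset.mem_coe.mpr (Finset.mem_Ico.mpr ⟨hm, hmM⟩), hroot⟩
  have hacc : AccPt z₀ (𝓟 (R ∩ U)) := by
    have hz₀' : AccPt z₀ (𝓟 R) := hz₀
    rw [accPt_iff_frequently] at hz₀' ⊢
    exact (hz₀'.and_eventually hU).mono fun w ⟨⟨hne', hwR⟩, hwU⟩ => ⟨hne', hwR, hwU⟩
  exact (Set.Infinite.of_accPt hacc) hfin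

end Analytic

/-! ### Theorem 15 (Bousquet-Mélou–Rechnitzer): finitely many accumulation points of poles -/

section Thm15

/-- **The pole theorem** behind Rechnitzer's Theorem 15: if `G = Σ_n H_n(x) yⁿ ∈ ℂ⟦x⟧⟦y⟧` is
D-finite in `y` (`IsDFiniteInY`) and every `H_n` is rational, then the set `S = ⋃_n S_n` of
poles of the coefficients has only finitely many accumulation points (its derived set is
finite). Proof: D-finite ⇒ P-recursive (`IsDFiniteInY.exists_recurrence`), so for `n` large
the new poles of `H_n` are zeros of `Λ(n)(x)`, `Λ ∈ ℂ[x][T]` non-zero, and these accumulate only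
at zeros of the leading coefficient of `Λ`. [cite: Rechnitzer2006Haruspicy2, Theorem 15] -/
theorem finite_derivedSet_iUnion_poleSet (G : PowerSeries (PowerSeries ℂ)) (hG : IsDFiniteInY G)
    (hrat : ∀ n, IsRationalSeries (coeff n G)) :
    (derivedSet (⋃ n, poleSet (coeff n G))).Finite := by
  obtain ⟨P, hP, hrec⟩ := hG.exists_recurrence
  obtain ⟨m₁, hm₁⟩ := exists_forall_eval_natCast_ne_zero hP
  set F : Set ℂ := ⋃ m ∈ Finset.range m₁, poleSet (coeff m G) with hF
  set R : Set ℂ := ⋃ m, ⋃ (_ : m₁ ≤ m), {z | (P.eval (m : Polynomial ℂ)).IsRoot z} with hR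
  have hsub : ∀ n, poleSet (coeff n G) ⊆ F ∪ R := by
    intro n
    induction n using Nat.strong_induction_on with
    | _ n ih =>
      rcases lt_or_ge n m₁ with hn | hn
      · exact fun z hz => Or.inl (Set.mem_iUnion₂.mpr ⟨n, Finset.mem_coe.mpr
          (Finset.mem_range.mpr hn), hz⟩)
      · obtain ⟨s, c, b, hb, hrec'⟩ := hrec n
        refine (poleSet_subset_of_recurrence (H := fun m => coeff m G) (hm₁ n hn) hrec'
          fun k _ => hrat _).trans ?_
        rintro z (hz | hz)
        · exact Or.inr (Set.mem_iUnion₂.mpr ⟨n, hn, hz⟩)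
        · obtain ⟨k, hk, hz'⟩ := Set.mem_iUnion₂.mp hz
          exact ih (b k) (hb k hk) hz'
  have hFfin : F.Finite :=
    Set.Finite.biUnion (Finset.range m₁).finite_toSet fun m _ => (hrat m).finite_poleSet
  have hdF : derivedSet F ⊆ ∅ := fun z hz => ((Set.Infinite.of_accPt hz) hFfin).elim
  refine (Polynomial.finite_setOf_isRoot (Polynomial.leadingCoeff_ne_zero.mpr hP)).subset ?_
  calc derivedSet (⋃ n, poleSet (coeff n G))
      ⊆ derivedSet (F ∪ R) := derivedSet_mono _ _ (Set.iUnion_subset hsub)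
    _ = derivedSet F ∪ derivedSet R := derivedSet_union _ _
    _ ⊆ _ := Set.union_subset (hdF.trans (Set.empty_subset _))
        (derivedSet_iUnion_roots_subset P m₁ hm₁)

/-- **Rechnitzer 2006, Theorem 15** (from Bousquet-Mélou–Rechnitzer, *Lattice animals and heaps
of dimers*, Discrete Math. 258 (2002) 235–274): "Let `f(x,y) = Σ_{n ≥ 0} yⁿ H_n(x)` be a
D-finite series in `y` with coefficients `H_n(x)` that are rational functions of `x`. For `n ≥ 0`
let `S_n` be the set of poles of `H_n(x)`, and let `S = ⋃_n S_n`. Then `S` has only a finite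
number of accumulation points." Here: `f ∈ ℂ⟦x⟧⟦y⟧` with every coefficient the expansion of a
rational function (`IsRationalSeries`), D-finite in the sense of eq. (7) (`IsDFiniteInY`),
`S_n = poleSet (coeff n f)`, and "finitely many accumulation points" = the derived set of `S`
is finite. PROVED below (`Rechnitzer2006_thm15_holds`).
[cite: Rechnitzer2006Haruspicy2, Theorem 15] -/
def Rechnitzer2006_thm15 : Prop :=
  ∀ f : PowerSeries (PowerSeries ℂ), IsDFiniteInY f → (∀ n, IsRationalSeries (coeff n f)) →
    (derivedSet (⋃ n, poleSet (coeff n f))).Finite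

/-- Theorem 15 holds. [cite: Rechnitzer2006Haruspicy2, Theorem 15] -/
theorem Rechnitzer2006_thm15_holds : Rechnitzer2006_thm15 :=
  fun f hf hrat => finite_derivedSet_iUnion_poleSet f hf hrat

end Thm15

/-! ### Roots of unity accumulate at infinitely many points -/

section RootsOfUnity

/-- The set of all roots of unity in `ℂ` has infinitely many accumulation points: it is an
infinite subset of the (compact) unit circle, so it has an accumulation point `z₀ ≠ 0`, and its
image under each of the infinitely many rotations `z ↦ ω z` (`ω` a root of unity, a
homeomorphism preserving the set) is again an accumulation point. [folklore] -/
theorem infinite_derivedSet_rootsOfUnity :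
    (derivedSet {z : ℂ | ∃ n : ℕ, 0 < n ∧ z ^ n = 1}).Infinite := by
  set U : Set ℂ := {z : ℂ | ∃ n : ℕ, 0 < n ∧ z ^ n = 1} with hU
  have hUinf : U.Infinite := by
    have hmem : ∀ n : ℕ, Complex.exp (2 * Real.pi * Complex.I / (n + 1 : ℕ)) ∈ U := fun n =>
      ⟨n + 1, Nat.succ_pos n,
        (Complex.isPrimitiveRoot_exp (n + 1) (Nat.succ_ne_zero n)).pow_eq_one⟩
    refine Set.infinite_of_injective_forall_mem
      (f := fun n : ℕ => Complex.exp (2 * Real.pi * Complex.I / (n + 1 : ℕ))) ?_ hmem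
    intro a b hab
    have ha := Complex.isPrimitiveRoot_exp (a + 1) (Nat.succ_ne_zero a)
    have hb := Complex.isPrimitiveRoot_exp (b + 1) (Nat.succ_ne_zero b)
    simp only at hab
    rw [hab] at ha
    exact Nat.succ_injective (ha.unique hb)
  have hUsub : U ⊆ Metric.sphere (0 : ℂ) 1 := by
    rintro z ⟨n, hn, hz⟩
    simp [Complex.norm_eq_one_of_pow_eq_one hz hn.ne']
  obtain ⟨z₀, hz₀K, hz₀⟩ := hUinf.exists_accPt_of_subset_isCompact (isCompact_sphere 0 1) hUsub
  have hz₀ne : z₀ ≠ 0 := by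
    rintro rfl
    simp at hz₀K
  have hrot : ∀ ω ∈ U, ω * z₀ ∈ derivedSet U := by
    rintro ω ⟨a, ha, hω⟩
    have hω0 : ω ≠ 0 := by
      rintro rfl
      rw [zero_pow ha.ne'] at hω
      exact zero_ne_one hω
    have himg : (fun z => ω * z) '' U ⊆ U := by
      rintro _ ⟨z, ⟨b, hb, hz⟩, rfl⟩
      refine ⟨a * b, Nat.mul_pos ha hb, ?_⟩
      rw [mul_pow, pow_mul, hω, one_pow, one_mul, mul_comm a b, pow_mul, hz, one_pow]
    have h1 : ω * z₀ ∈ (fun z => ω * z) '' derivedSet U := ⟨z₀, hz₀, rfl⟩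
    exact derivedSet_mono _ _ himg
      ((continuous_const.mul continuous_id).image_derivedSet (mul_right_injective₀ hω0) h1)
  have hsub : (fun ω => ω * z₀) '' U ⊆ derivedSet U := by
    rintro _ ⟨ω, hω, rfl⟩
    exact hrot ω hω
  exact (hUinf.image (mul_left_injective₀ hz₀ne).injOn).mono hsub

/-- Hence so does the set of primitive `k`-th roots of unity with `k ≠ 2` (all roots of unity but
`-1`): it has infinitely many accumulation points (in fact it is dense on `|x| = 1`, which is
all the source uses). [folklore] -/
theorem infinite_derivedSet_primitiveRoots :
    (derivedSet {z : ℂ | ∃ k : ℕ, 1 ≤ k ∧ k ≠ 2 ∧ IsPrimitiveRoot z k}).Infinite := by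
  have hUT : {z : ℂ | ∃ n : ℕ, 0 < n ∧ z ^ n = 1} ⊆
      {z : ℂ | ∃ k : ℕ, 1 ≤ k ∧ k ≠ 2 ∧ IsPrimitiveRoot z k} ∪ {-1} := by
    rintro z ⟨n, hn, hz⟩
    have hfin : IsOfFinOrder z := isOfFinOrder_iff_pow_eq_one.mpr ⟨n, hn, hz⟩
    have hprim : IsPrimitiveRoot z (orderOf z) := IsPrimitiveRoot.orderOf z
    by_cases h2 : orderOf z = 2
    · right
      rw [h2] at hprim
      exact hprim.eq_neg_one_of_two_right
    · left
      exact ⟨orderOf z, hfin.orderOf_pos, h2, hprim⟩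
  refine infinite_derivedSet_rootsOfUnity.mono ((derivedSet_mono _ _ hUT).trans ?_)
  rw [derivedSet_union]
  refine Set.union_subset le_rfl fun z hz => ?_
  exact ((Set.Infinite.of_accPt hz) (Set.finite_singleton _)).elim

end RootsOfUnity

/-! ### Corollary 27 from Theorems 1, 15 and 16 -/

section Assembly

/-- Base change `ℚ → ℂ` of `H_n` (its coefficients are natural numbers).
[cite: Rechnitzer2006Haruspicy2, §1, eq. (3)] -/
theorem map_sapRowGF (f : ℚ →+* ℂ) (n : ℕ) :
    PowerSeries.map f (sapRowGF ℚ n) = sapRowGF ℂ n := by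
  ext m
  simp [sapRowGF, coeff_map, coeff_mk]

/-- `[yⁿ] P(x,y) = H_n(x)`. [cite: Rechnitzer2006Haruspicy2, §1, eq. (3)] -/
theorem coeff_sapAnisotropicGF (K : Type*) [Semiring K] (n : ℕ) :
    coeff n (sapAnisotropicGF K) = sapRowGF K n := by
  simp [sapAnisotropicGF, coeff_mk]

/-- Theorem 1 (rationality with cyclotomic denominators over `ℚ`) makes every `H_n` a rational
series over `ℂ` — the standing hypothesis of Theorem 15.
[cite: Rechnitzer2006Haruspicy2, Theorem 1] -/
theorem isRationalSeries_sapRowGF (h1 : Rechnitzer2006_thm1) (n : ℕ) :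
    IsRationalSeries (sapRowGF ℂ n) := by
  obtain ⟨N, s, -, hD⟩ := h1 n
  set D := (s.map fun k => Polynomial.cyclotomic k ℚ).prod with hDdef
  have hD0 : D ≠ 0 := by
    rw [hDdef, Ne, Multiset.prod_eq_zero_iff, Multiset.mem_map]
    rintro ⟨k, -, hk⟩
    exact Polynomial.cyclotomic_ne_zero k ℚ hk
  refine ⟨D.map (algebraMap ℚ ℂ),
    (Polynomial.map_ne_zero_iff (algebraMap ℚ ℂ).injective).mpr hD0, N.map (algebraMap ℚ ℂ), ?_⟩
  rw [Polynomial.polynomial_map_coe, Polynomial.polynomial_map_coe,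
    ← map_sapRowGF (algebraMap ℚ ℂ), ← map_mul, hD]

/-- Theorem 16 over `ℂ`: for `k ≥ 1`, `k ≠ 2`, every primitive `k`-th root of unity (zero of
`Ψ_k`) is a pole of `H_{3k-2}` — a zero of EVERY denominator of `H_{3k-2}` over `ℂ`, because
`Ψ_k` divides the lowest-terms denominator over `ℚ` and lowest terms survive base change.
[cite: Rechnitzer2006Haruspicy2, Theorem 16] -/
theorem mem_poleSet_sapRowGF (h16 : Rechnitzer2006_thm16) {k : ℕ} (hk : 1 ≤ k) (hk2 : k ≠ 2)
    {ζ : ℂ} (hζ : IsPrimitiveRoot ζ k) : ζ ∈ poleSet (sapRowGF ℂ (3 * k - 2)) := by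
  obtain ⟨N, D, hND, hDH, hdvd, -⟩ := h16 k hk hk2
  rw [← map_sapRowGF (algebraMap ℚ ℂ)]
  refine mem_poleSet_map_of_isCoprime (algebraMap ℚ ℂ) hND hDH ?_
  have hroot : (Polynomial.cyclotomic k ℂ).IsRoot ζ := by
    haveI : NeZero (k : ℂ) := ⟨by exact_mod_cast (by omega : k ≠ 0)⟩
    exact Polynomial.isRoot_cyclotomic_iff.mpr hζ
  refine hroot.dvd ?_
  rw [← Polynomial.map_cyclotomic k (algebraMap ℚ ℂ)]
  exact Polynomial.map_dvd _ hdvd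

/-- The poles of the rows of `P(x,y)` over `ℂ` contain all roots of unity other than `-1`
(given Theorem 16). [cite: Rechnitzer2006Haruspicy2, Corollary 27 (proof)] -/
theorem primitiveRoots_subset_iUnion_poleSet (h16 : Rechnitzer2006_thm16) :
    {z : ℂ | ∃ k : ℕ, 1 ≤ k ∧ k ≠ 2 ∧ IsPrimitiveRoot z k} ⊆
      ⋃ n, poleSet (coeff n (sapAnisotropicGF ℂ)) := by
  rintro ζ ⟨k, hk, hk2, hζ⟩
  refine Set.mem_iUnion.mpr ⟨3 * k - 2, ?_⟩
  rw [coeff_sapAnisotropicGF]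
  exact mem_poleSet_sapRowGF h16 hk hk2 hζ

/-- **Corollary 27 from Theorems 1 and 16** (the printed proof, with Theorem 15 now a theorem
of the library): by Theorem 16 the pole set `S = ⋃_n S_n` of the coefficients `H_n` contains
every root of unity except `-1`, hence has infinitely many accumulation points
(`infinite_derivedSet_primitiveRoots`); by Theorem 1 the `H_n` are rational, so Theorem 15
(`Rechnitzer2006_thm15_holds`) forbids a non-trivial equation `Σ Q_j(x,y) ∂ʲ_y P = 0`.
What remains for an unconditional `Rechnitzer2006_cor27` is exactly the haruspicy input:
the named facts `Rechnitzer2006_thm1` and `Rechnitzer2006_thm16`.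
[cite: Rechnitzer2006Haruspicy2, Corollary 27] -/
theorem Rechnitzer2006_cor27_of_thm1_thm16 (h1 : Rechnitzer2006_thm1)
    (h16 : Rechnitzer2006_thm16) : Rechnitzer2006_cor27 := by
  intro hDF
  have hfin := Rechnitzer2006_thm15_holds (sapAnisotropicGF ℂ) hDF fun n => by
    rw [coeff_sapAnisotropicGF]
    exact isRationalSeries_sapRowGF h1 n
  exact infinite_derivedSet_primitiveRoots.mono
    (derivedSet_mono _ _ (primitiveRoots_subset_iUnion_poleSet h16)) hfin

/-- The barrier `SAPAnisotropicNotDFinite` (definitionally Corollary 27) thus reduces to the two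
haruspicy facts. [cite: Rechnitzer2006Haruspicy2, Corollary 27] -/
theorem sapAnisotropicNotDFinite_of_thm1_thm16 (h1 : Rechnitzer2006_thm1)
    (h16 : Rechnitzer2006_thm16) : SAPAnisotropicNotDFinite :=
  Rechnitzer2006_cor27_of_thm1_thm16 h1 h16

end Assembly

/-! ### Beyond D-finite: `P` is not a quotient of D-finite series (closure of the pole obstruction) -/

section RationalClosure

variable {K : Type*} [Field K]

/-- `0` has denominator `1`. [folklore] -/
theorem isDenom_zero_one : IsDenom (0 : PowerSeries K) 1 :=
  ⟨one_ne_zero, 0, by simp⟩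

/-- A polynomial has denominator `1`. [folklore] -/
theorem isDenom_coe_one (N : K[X]) : IsDenom (N : PowerSeries K) 1 :=
  ⟨one_ne_zero, N, by simp⟩

/-- Polynomials are rational series. [folklore] -/
theorem isRationalSeries_coe (N : K[X]) : IsRationalSeries (N : PowerSeries K) :=
  ⟨1, isDenom_coe_one N⟩

/-- A polynomial has no poles. [folklore] -/
theorem poleSet_coe (N : K[X]) : poleSet (N : PowerSeries K) = ∅ := by
  ext z
  simp only [Set.mem_empty_iff_false, iff_false]
  intro hz
  have := hz 1 (isDenom_coe_one N)
  simp at this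

/-- Denominators multiply under products. [folklore] -/
theorem IsDenom.mul {f g : PowerSeries K} {D E : K[X]} (hf : IsDenom f D) (hg : IsDenom g E) :
    IsDenom (f * g) (D * E) := by
  obtain ⟨hD, N, hN⟩ := hf
  obtain ⟨hE, M, hM⟩ := hg
  refine ⟨mul_ne_zero hD hE, N * M, ?_⟩
  rw [Polynomial.coe_mul, Polynomial.coe_mul, ← hN, ← hM]
  ring

/-- Denominators multiply under sums. [folklore] -/
theorem IsDenom.add {f g : PowerSeries K} {D E : K[X]} (hf : IsDenom f D) (hg : IsDenom g E) :
    IsDenom (f + g) (D * E) := by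
  obtain ⟨hD, N, hN⟩ := hf
  obtain ⟨hE, M, hM⟩ := hg
  refine ⟨mul_ne_zero hD hE, N * E + D * M, ?_⟩
  rw [Polynomial.coe_mul, Polynomial.coe_add, Polynomial.coe_mul, Polynomial.coe_mul, ← hN, ← hM]
  ring

/-- Denominators are unchanged by negation. [folklore] -/
theorem IsDenom.neg {f : PowerSeries K} {D : K[X]} (hf : IsDenom f D) : IsDenom (-f) D := by
  obtain ⟨hD, N, hN⟩ := hf
  refine ⟨hD, -N, ?_⟩
  rw [coe_poly_neg, ← hN]
  ring

/-- Denominators multiply under finite sums. [folklore] -/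
theorem IsDenom.sum {ι : Type*} (s : Finset ι) {f : ι → PowerSeries K} {D : ι → K[X]}
    (h : ∀ i ∈ s, IsDenom (f i) (D i)) : IsDenom (∑ i ∈ s, f i) (∏ i ∈ s, D i) := by
  classical
  induction s using Finset.induction_on with
  | empty => simpa using (isDenom_zero_one (K := K))
  | insert a s ha ih =>
    rw [Finset.sum_insert ha, Finset.prod_insert ha]
    exact (h a (Finset.mem_insert_self a s)).add
      (ih fun i hi => h i (Finset.mem_insert_of_mem hi))

/-- Rational series are closed under products. [folklore] -/
theorem IsRationalSeries.mul {f g : PowerSeries K} (hf : IsRationalSeries f)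
    (hg : IsRationalSeries g) : IsRationalSeries (f * g) := by
  obtain ⟨D, hD⟩ := hf
  obtain ⟨E, hE⟩ := hg
  exact ⟨D * E, hD.mul hE⟩

/-- Rational series are closed under negation. [folklore] -/
theorem IsRationalSeries.neg {f : PowerSeries K} (hf : IsRationalSeries f) :
    IsRationalSeries (-f) := by
  obtain ⟨D, hD⟩ := hf
  exact ⟨D, hD.neg⟩

/-- The poles of a product are poles of a factor. [folklore] -/
theorem poleSet_mul_subset {f g : PowerSeries K} (hf : IsRationalSeries f)
    (hg : IsRationalSeries g) : poleSet (f * g) ⊆ poleSet f ∪ poleSet g := by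
  obtain ⟨D, hD, hDeq⟩ := hf.exists_poleSet_eq
  obtain ⟨E, hE, hEeq⟩ := hg.exists_poleSet_eq
  intro z hz
  have h := poleSet_subset_of_isDenom (hD.mul hE) hz
  simp only [Set.mem_setOf_eq, Polynomial.root_mul] at h
  rw [hDeq, hEeq]
  exact h

/-- Negation does not change poles. [folklore] -/
theorem poleSet_neg_subset {f : PowerSeries K} (hf : IsRationalSeries f) :
    poleSet (-f) ⊆ poleSet f := by
  obtain ⟨D, hD, hDeq⟩ := hf.exists_poleSet_eq
  intro z hz
  rw [hDeq]
  exact poleSet_subset_of_isDenom hD.neg hz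

/-- **Pole propagation through a linear relation with rational right-hand side**: if
`ℓ · f = g₀ + Σ_{i ∈ s} g_i` with `ℓ ∈ K[x]` non-zero and all `g` rational, then `f` is rational
and each of its poles is a zero of `ℓ` or a pole of some `g`. [folklore] -/
theorem poleSet_subset_of_eq_add_sum {f g₀ : PowerSeries K} {ℓ : K[X]} (hℓ : ℓ ≠ 0)
    {ι : Type*} {s : Finset ι} {g : ι → PowerSeries K}
    (h : (ℓ : PowerSeries K) * f = g₀ + ∑ i ∈ s, g i) (h₀ : IsRationalSeries g₀)
    (hrat : ∀ i ∈ s, IsRationalSeries (g i)) :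
    IsRationalSeries f ∧
      poleSet f ⊆ {z | ℓ.IsRoot z} ∪ (poleSet g₀ ∪ ⋃ i ∈ s, poleSet (g i)) := by
  classical
  obtain ⟨D₀, hD₀, hD₀eq⟩ := h₀.exists_poleSet_eq
  choose! D hD hDeq using fun i (hi : i ∈ s) => (hrat i hi).exists_poleSet_eq
  obtain ⟨hprod, N, hN⟩ := hD₀.add (IsDenom.sum s hD)
  have hden : IsDenom f (ℓ * (D₀ * ∏ i ∈ s, D i)) := by
    refine ⟨mul_ne_zero hℓ hprod, N, ?_⟩
    calc ((ℓ * (D₀ * ∏ i ∈ s, D i) : K[X]) : PowerSeries K) * f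
        = ((D₀ * ∏ i ∈ s, D i : K[X]) : PowerSeries K) * ((ℓ : PowerSeries K) * f) := by
          rw [Polynomial.coe_mul]; ring
      _ = N := by rw [h, hN]
  refine ⟨⟨_, hden⟩, fun z hz => ?_⟩
  have hroot := poleSet_subset_of_isDenom hden hz
  simp only [Set.mem_setOf_eq, Polynomial.root_mul, Polynomial.isRoot_prod] at hroot
  rcases hroot with h1 | h2 | ⟨i, hi, hi'⟩
  · exact Or.inl h1
  · refine Or.inr (Or.inl ?_)
    rw [hD₀eq]
    exact h2
  · refine Or.inr (Or.inr (Set.mem_iUnion₂.mpr ⟨i, hi, ?_⟩))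
    rw [hDeq i hi]
    exact hi'

end RationalClosure

/-- **Strengthening of Corollary 27 (given Theorem 16): `P(x,y)` is not a quotient of D-finite
series.** If `A, B ∈ ℂ⟦x⟧⟦y⟧` are D-finite in `y` with rational rows and the constant row `B₀(x)`
of `B` is non-zero, then `B · P ≠ A`: the rows of `B⁻¹A` satisfy
`B₀ Pₙ = Aₙ - Σ_{i ≥ 1} Bᵢ Pₙ₋ᵢ`, so their poles lie among the zeros of the numerator of `B₀`
and the poles of the rows of `A` and `B`, which have finitely many accumulation points
(Theorem 15), whereas Theorem 16 makes every root of unity other than `-1` a pole of some row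
of `P`. With `B = 1` this is Corollary 27 (there Theorem 1 supplies the rationality of the rows).
This quotient form is NOT stated in the source: it is a formal consequence, proved here, of
Theorem 15 (proved above) and the named fact Theorem 16; it records that the pole obstruction
behind the barrier `SAPAnisotropicNotDFinite` is stable under division, so that e.g. ratios of
D-finite (holonomic) closed forms are excluded as well.
[cite: Rechnitzer2006Haruspicy2, Theorems 15, 16 and Corollary 27] -/
theorem sapAnisotropicGF_ne_quotient_of_thm16 (h16 : Rechnitzer2006_thm16)
    {A B : PowerSeries (PowerSeries ℂ)} (hA : IsDFiniteInY A) (hB : IsDFiniteInY B)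
    (hArat : ∀ n, IsRationalSeries (coeff n A)) (hBrat : ∀ n, IsRationalSeries (coeff n B))
    (hB0 : coeff 0 B ≠ 0) : B * sapAnisotropicGF ℂ ≠ A := by
  classical
  intro hBA
  set P := sapAnisotropicGF ℂ with hP
  -- lowest terms for the constant row `B₀ = N₀/D₀`
  obtain ⟨D₀, hD₀, -⟩ := (hBrat 0).exists_poleSet_eq
  obtain ⟨hD₀0, N₀, hN₀⟩ := hD₀
  have hN₀0 : N₀ ≠ 0 := by
    intro h0
    have h' : (D₀ : PowerSeries ℂ) * coeff 0 B = 0 := by rw [hN₀, h0, Polynomial.coe_zero]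
    rcases mul_eq_zero.mp h' with h1 | h1
    · exact hD₀0 (by exact_mod_cast h1)
    · exact hB0 h1
  -- the row identity `Σ_{i+j=n} Bᵢ Pⱼ = Aₙ`
  have hrow : ∀ n, ∑ p ∈ antidiagonal n, coeff p.1 B * coeff p.2 P = coeff n A := fun n => by
    rw [← coeff_mul, hBA]
  -- rearranged and multiplied by `D₀`
  have hid : ∀ n, ((N₀ : PowerSeries ℂ)) * coeff n P =
      (D₀ : PowerSeries ℂ) * coeff n A +
        ∑ p ∈ (antidiagonal n).erase (0, n), -((D₀ : PowerSeries ℂ) * coeff p.1 B * coeff p.2 P) := by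
    intro n
    have h0n : ((0, n) : ℕ × ℕ) ∈ antidiagonal n := by simp
    have h1 := hrow n
    rw [← Finset.add_sum_erase _ _ h0n] at h1
    have h2 : coeff 0 B * coeff n P =
        coeff n A - ∑ p ∈ (antidiagonal n).erase (0, n), coeff p.1 B * coeff p.2 P :=
      eq_sub_of_add_eq h1
    rw [← hN₀, mul_assoc, h2, mul_sub, Finset.mul_sum, sub_eq_add_neg, ← Finset.sum_neg_distrib]
    refine congrArg _ (Finset.sum_congr rfl fun p _ => ?_)
    rw [mul_assoc]
  -- rationality and pole location of the rows of `P`, by strong induction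
  set T : Set ℂ := {z | N₀.IsRoot z} ∪ ((⋃ m, poleSet (coeff m A)) ∪ ⋃ m, poleSet (coeff m B))
    with hT
  have key : ∀ n, IsRationalSeries (coeff n P) ∧ poleSet (coeff n P) ⊆ T := by
    intro n
    induction n using Nat.strong_induction_on with
    | _ n ih =>
      have hmem : ∀ p ∈ (antidiagonal n).erase ((0 : ℕ), n), p.2 < n := by
        intro p hp
        have hp' := Finset.mem_erase.mp hp
        have hsum : p.1 + p.2 = n := mem_antidiagonal.mp hp'.2
        have hne : p ≠ (0, n) := hp'.1
        by_contra hlt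
        have h2 : p.2 = n := by omega
        have h1 : p.1 = 0 := by omega
        exact hne (Prod.ext h1 h2)
      have hrat0 : IsRationalSeries ((D₀ : PowerSeries ℂ) * coeff n A) :=
        (isRationalSeries_coe D₀).mul (hArat n)
      have hrati : ∀ p ∈ (antidiagonal n).erase ((0 : ℕ), n),
          IsRationalSeries (-((D₀ : PowerSeries ℂ) * coeff p.1 B * coeff p.2 P)) := fun p hp =>
        (((isRationalSeries_coe D₀).mul (hBrat p.1)).mul (ih p.2 (hmem p hp)).1).neg
      obtain ⟨hratn, hsub⟩ := poleSet_subset_of_eq_add_sum hN₀0 (hid n) hrat0 hrati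
      refine ⟨hratn, hsub.trans ?_⟩
      rintro z (hz | hz | hz)
      · exact Or.inl hz
      · -- pole of `D₀ · Aₙ`
        have := poleSet_mul_subset (isRationalSeries_coe D₀) (hArat n) hz
        rw [poleSet_coe, Set.empty_union] at this
        exact Or.inr (Or.inl (Set.mem_iUnion.mpr ⟨n, this⟩))
      · obtain ⟨p, hp, hz'⟩ := Set.mem_iUnion₂.mp hz
        have hr1 : IsRationalSeries ((D₀ : PowerSeries ℂ) * coeff p.1 B) :=
          (isRationalSeries_coe D₀).mul (hBrat p.1)
        have hz2 := poleSet_neg_subset (hr1.mul (ih p.2 (hmem p hp)).1) hz'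
        rcases poleSet_mul_subset hr1 (ih p.2 (hmem p hp)).1 hz2 with hz3 | hz3
        · have := poleSet_mul_subset (isRationalSeries_coe D₀) (hBrat p.1) hz3
          rw [poleSet_coe, Set.empty_union] at this
          exact Or.inr (Or.inr (Set.mem_iUnion.mpr ⟨p.1, this⟩))
        · exact (ih p.2 (hmem p hp)).2 hz3
  -- accumulation points
  have hfinA := finite_derivedSet_iUnion_poleSet A hA hArat
  have hfinB := finite_derivedSet_iUnion_poleSet B hB hBrat
  have hfinN : (derivedSet {z : ℂ | N₀.IsRoot z}) ⊆ ∅ := fun z hz =>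
    ((Set.Infinite.of_accPt hz) (Polynomial.finite_setOf_isRoot hN₀0)).elim
  have hTfin : (derivedSet T).Finite := by
    rw [hT, derivedSet_union, derivedSet_union]
    exact ((Set.finite_empty.subset hfinN).union (hfinA.union hfinB))
  have hPT : (⋃ n, poleSet (coeff n P)) ⊆ T := Set.iUnion_subset fun n => (key n).2
  exact infinite_derivedSet_primitiveRoots.mono
    ((derivedSet_mono _ _ (primitiveRoots_subset_iUnion_poleSet h16)).trans
      (derivedSet_mono _ _ hPT)) hTfin

/-- In particular (with `B = 1`): Corollary 27 from Theorem 16 and the rationality of the rows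
alone. [cite: Rechnitzer2006Haruspicy2, Corollary 27] -/
theorem Rechnitzer2006_cor27_of_thm16_of_isRationalSeries (h16 : Rechnitzer2006_thm16)
    (hrat : ∀ n, IsRationalSeries (sapRowGF ℂ n)) : Rechnitzer2006_cor27 := by
  intro hDF
  have h1 : IsDFiniteInY (1 : PowerSeries (PowerSeries ℂ)) := by
    simpa using isDFiniteInY_polyXY (1 : Polynomial (Polynomial ℂ))
  refine sapAnisotropicGF_ne_quotient_of_thm16 h16 hDF h1 ?_ ?_ ?_ (one_mul _)
  · intro n
    rw [coeff_sapAnisotropicGF]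
    exact hrat n
  · intro n
    rw [coeff_one]
    split_ifs
    · exact ⟨1, one_ne_zero, 1, by simp⟩
    · exact ⟨1, isDenom_zero_one⟩
  · rw [coeff_one, if_pos rfl]
    exact one_ne_zero


end Literature.Barriers.CriticalPhenomena
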